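import Summits.BirchSwinnertonDyer.BirchSwinnertonDyer.Theorems.CyclotomicUntwistInertiaOverCyclotomicNine
import Literature.NumberTheory.EllipticCurves.InertiaInvariantsAdditiveProofs
import Literature.NumberTheory.EllipticCurves.TateModuleFixedPointsProofs
import HarnessLib

/-!
# Wild inertia at `3` on the principal-series rows — UNCONDITIONALLY (no modularity, no Carayol, no newform):
# the registered stub `stub_WILD` of line `dfrob_wan` (K1 = stmt-BirchSwinnertonDyer-21580, skeleton v7) closed print-free

Cell `pub/bsd-wall` (D-0145 line `route-BirchSwinnertonDyer-CyclotomicUntwist`), seat `bsd-line-cycu-p5` (width seat 5,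
gen 15). THEOREMS ONLY (no definition, no named fact, no `sorry`; standard axioms); helper `--supports` the crux K1
stmt-BirchSwinnertonDyer-21580 (`PSRankOneLowerHalfAtThree`) — it proves the registered stub `stub_WILD` of the lead's
(cycu-p1 g8) skeleton `Cruxes/PSRankOneLowerHalfAtThree/Lines/dfrob_wan.lean` v7 VERBATIM (`stub_WILD_unconditional`), and
thereby also serves the child C1 stmt-BirchSwinnertonDyer-27548 (the binder `hwild` of the lead's capstone
`PSC1OfPrint.psUntwistedLFunctionAtThree_of_print_of_wild`). BSD is not proved by this file; no crux and no child of
the route is proved by it (K1/K2 stay OPEN and WHOLE: research stubs C4/C5 + print; C1 stays print-conditional).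

WHAT. For every globally minimal `W/ℚ` on a principal-series row at `3` (`ClassO6 W 3`: wild additive reduction at `3`;
`v₃(Δ_min)` even with unit part `≡ 1 (mod 3)`) there are a place `v ∋ 3` of `ℚ`, a prime `𝔓 ∣ v` of `ℤ̄` and an
inertia element `i ∈ I_𝔓 ≤ Γ_ℚ` with mod-`9` cyclotomic character `χ₉(i) = 4` acting NON-trivially on the rational
Tate module `V₂(W)` — «the `2`-adic inertia image at `3` is WILD» (`stub_WILD_unconditional`; every prime `ℓ ≠ 3` in
`exists_inertia_nine_eq_four_rationalGaloisRepTate_ne_one`). The sibling file `CyclotomicUntwistInertiaWildAtThree`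
(cycu-p3 g10) proves the same conclusion from modularity of `W` and the two PRINT facts
`Hida2000_thm326_exists_galoisRep` / `Carayol1986_eulerFactor` (Carayol's Euler factors of the newform and of its
twist by `(·/3)`); here NO print input is used.

HOW (curve side only, every arithmetic input a theorem of the tree).
* `ClassO6 W 3 ⟹ ¬ TypeG W 3` (`ClassO6.not_typeG_three`, cell b2b-bsdres: an additive pair of Delbourgo type (G) at
  `3` is TAME, `f₃ = 2`, by Tate's algorithm on the twist by `−3`): so over the top intermediate field `K ≅ ℚ(ζ₃)` of
  the third cyclotomic field, `W ×_ℚ K` does NOT have good reduction at some place `w ∋ 3`.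
* The criterion of Néron–Ogg–Shafarevich (`WeierstrassCurve.neronOggShafarevich_holds`, Silverman *AEC* VII.7.1
  (c) ⇒ (a), PROVED in the tree from Kodaira–Néron over `K_w^nr`): some `τ` in an inertia group `I_𝔔 ≤ Γ_K`, `𝔔 ∣ w`,
  moves a point of `T_ℓ(W ×_ℚ K)`.
* Restriction `Γ_K → Γ_ℚ` (`absGaloisRestrict`; `absGaloisRestrict_mem_inertia_comap`, `tateModuleEquiv_symm_smul`,
  `comap_absIntegersMap_mem_primesAbove`): `i = τ|_{ℚ̄}` lies in `I_𝔓`, `𝔓 = 𝔔 ∩ ℤ̄ ∣ v = w ∩ ℤ ∋ 3`, moves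
  `T_ℓ(W) ≅ T_ℓ(W ×_ℚ K)`, hence acts non-trivially on `V_ℓ(W)` (`T_ℓ ↪ V_ℓ`, `TateModule.toRational_injective`), and
  fixes the image of `ζ₃ ∈ K` in `ℚ̄`, so `χ₉(i) ∈ {1, 4, 7}` (`modNCyclotomicCharacter_nine_of_smul_eq_of_isPrimitiveRoot_three`).
* `χ₉(i) = 1` is excluded by the lead's `InertiaOverCyclotomicNine.rationalGaloisRepTate_apply_eq_self_of_mem_inertia_…`
  (good reduction of `W` over `ℚ(ζ₉)` above `3` on the principal-series rows, cycu-p3's `GNineFrobeniusTrace`, and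
  Prop. VII.4.1): an inertia element fixing `ζ₉` acts trivially on `V_ℓ(W)`. If `χ₉(i) = 7`, replace `i` by `i²`
  (`χ₉(i²) = 4`; `ρ(i²) = 1` would give `ρ(i) = ρ(i³) = 1` as `χ₉(i³) = 1`).

References: [cite: SilvermanAEC2009, Thm. VII.7.1 and Prop. VII.4.1] · [cite: SerreTate1968, §1–§2] ·
[cite: NeukirchANT1999, Ch. I §9 (9.4)–(9.6)] · [cite: Delbourgo1998, §1.5 hypothesis (G)] ·
[cite: SilvermanATAEC1994, Thm. IV.10.2 (a)].
-/

set_option autoImplicit false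
-- single-conjunct summit: `Summit.BirchSwinnertonDyer.BirchSwinnertonDyer.…` repeats the name by design
set_option linter.dupNamespace false

noncomputable section

open scoped NumberField
open NumberField IsDedekindDomain Field IsCyclotomicExtension
  Literature.NumberTheory.GaloisRepresentations Literature.NumberTheory.EllipticCurves
  Summit.BirchSwinnertonDyer.Rank1Residual.Additive
  Summit.BirchSwinnertonDyer.BirchSwinnertonDyer.Theorems.InertiaOverCyclotomicNine

namespace Summit.BirchSwinnertonDyer.BirchSwinnertonDyer.Theorems.InertiaWildAtThreeUnconditional

/-! ### §1 Generic bookkeeping: a moved point of `T_p` is a moved vector of `V_p` -/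

/-- If `g ∈ Γ_K` moves a point of the Tate module `T_p E`, then `ρ_{E,p}(g) ≠ 1` on the rational Tate module
`V_p E = T_p E ⊗ ℚ_p` (`T_p E ↪ V_p E`, the Tate module being torsion-free). [folklore] -/
theorem rationalGaloisRepTate_ne_one_of_smul_ne {K : Type} [Field K] (X : WeierstrassCurve K)
    (p : ℕ) [Fact p.Prime] {g : absoluteGaloisGroup K} {a : X.tateModule p} (h : g • a ≠ a) :
    X.rationalGaloisRepTate p g ≠ 1 := by
  intro h1
  apply h
  apply TateModule.toRational_injective
  rw [← rationalTateRepresentation_toRational _ _ p g a]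
  change X.rationalGaloisRepTate p g (TateModule.toRational p a) = TateModule.toRational p a
  rw [h1, Module.End.one_apply]

/-- If `ρ_{E,p}(g) ≠ 1` on `T_p E` (as an endomorphism), some point of `T_p E` is moved by `g`. [folklore] -/
theorem exists_smul_ne_of_galoisRepTate_ne_one {K : Type} [Field K] (X : WeierstrassCurve K)
    (p : ℕ) [Fact p.Prime] {g : absoluteGaloisGroup K} (h : X.galoisRepTate p g ≠ 1) :
    ∃ a : X.tateModule p, g • a ≠ a := by
  by_contra hall
  push Not at hall
  exact h (LinearMap.ext fun a => by rw [WeierstrassCurve.galoisRepTate_apply_apply, hall a]; rfl)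

/-! ### §2 The mod-`9` cyclotomic character of an element fixing a primitive cube root of unity -/

/-- If `i ∈ Γ_ℚ` fixes a primitive cube root of unity `ω ∈ ℚ̄`, then `χ₉(i) ≡ 1 (mod 3)`, i.e.
`χ₉(i) ∈ {1, 4, 7} ⊂ (ℤ/9)ˣ` (`i • ω = ω^{χ₉(i)}` as `ω⁹ = 1`). [folklore] -/
theorem modNCyclotomicCharacter_nine_of_smul_eq_of_isPrimitiveRoot_three
    {ω : AlgebraicClosure ℚ} (hω : IsPrimitiveRoot ω 3) {i : absoluteGaloisGroup ℚ} (hi : i • ω = ω) :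
    (modNCyclotomicCharacter ℚ 9 i : ZMod 9) = 1 ∨ (modNCyclotomicCharacter ℚ 9 i : ZMod 9) = 4 ∨
      (modNCyclotomicCharacter ℚ 9 i : ZMod 9) = 7 := by
  haveI : NeZero ((9 : ℕ) : ℚ) := ⟨by norm_num⟩
  haveI : Fact (1 < 9) := ⟨by norm_num⟩
  set n : ℕ := ((modNCyclotomicCharacter ℚ 9 i : (ZMod 9)ˣ) : ZMod 9).val with hn
  have h9 : ω ^ 9 = 1 := by
    rw [show (9 : ℕ) = 3 * 3 by norm_num, pow_mul, hω.pow_eq_one, one_pow]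
  have hspec := modNCyclotomicCharacter_spec ℚ 9 i ω h9
  rw [hi, ← hn] at hspec
  -- `ω = ω ^ n`, `1 ≤ n < 9` ⟹ `3 ∣ n - 1`
  have hn9 : n < 9 := ZMod.val_lt _
  have hn0 : n ≠ 0 := by
    intro h0
    have : ((modNCyclotomicCharacter ℚ 9 i : (ZMod 9)ˣ) : ZMod 9) = 0 := (ZMod.val_eq_zero _).mp (hn ▸ h0)
    exact (modNCyclotomicCharacter ℚ 9 i).ne_zero this
  have hω0 : ω ≠ 0 := hω.ne_zero (by norm_num)
  have hdvd : 3 ∣ n - 1 := by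
    rw [← hω.pow_eq_one_iff_dvd]
    obtain ⟨m, hm⟩ : ∃ m, n = m + 1 := Nat.exists_eq_succ_of_ne_zero hn0
    rw [hm, Nat.add_sub_cancel]
    rw [hm, pow_succ] at hspec
    -- `ω = ω ^ m * ω`
    have := mul_right_cancel₀ hω0 (hspec.symm.trans (one_mul ω).symm)
    exact this
  have hcast : ((modNCyclotomicCharacter ℚ 9 i : (ZMod 9)ˣ) : ZMod 9) = (n : ZMod 9) := by
    rw [hn, ZMod.natCast_zmod_val]
  rw [hcast]
  have : n = 1 ∨ n = 4 ∨ n = 7 := by omega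
  rcases this with h | h | h <;> rw [h] <;> decide

/-! ### §3 The Galois core: bad reduction over a field containing `ζ₃` gives the wild inertia element -/

/-- **Core.** Let `W/ℚ` be on a principal-series row at `3` (`ClassO6 W 3`, `v₃(Δ_min)` even, unit part `≡ 1 (mod 3)`),
`F` an intermediate field of a number field `L/ℚ` containing a primitive cube root of unity `ζ`, and `w ∋ 3` a place of
`F` at which `W ×_ℚ F` does NOT have good reduction. Then some `i` in an inertia group `I_𝔓 ≤ Γ_ℚ` above `3` has
`χ₉(i) = 4` and acts non-trivially on `V_ℓ(W)`, for every prime `ℓ ≠ 3`. Proof: by the criterion of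
Néron–Ogg–Shafarevich (tree theorem `WeierstrassCurve.neronOggShafarevich_holds`) some `τ` in an inertia group
`I_𝔔 ≤ Γ_F`, `𝔔 ∣ w`, moves `T_ℓ(W ×_ℚ F)`; its restriction `i = τ|_{ℚ̄} ∈ I_𝔓`, `𝔓 = 𝔔 ∩ ℤ̄`, moves
`T_ℓ(W) ≅ T_ℓ(W ×_ℚ F)` hence `V_ℓ(W)`, and fixes the image of `ζ`,
so `χ₉(i) ∈ {1, 4, 7}`; `χ₉(i) = 1` is excluded by the tree theorem «on a principal-series row an inertia element fixing
`ζ₉` acts trivially on `V_ℓ(W)`» (`InertiaOverCyclotomicNine`, good reduction over `ℚ(ζ₉)`); if `χ₉(i) = 7` replace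
`i` by `i²` (`χ₉(i²) = 4`, and `ρ(i²) = 1` would force `ρ(i) = ρ(i³) = 1` as `χ₉(i³) = 1`).
[cite: SilvermanAEC2009, Thm. VII.7.1] [cite: SerreTate1968, §1–§2] [cite: NeukirchANT1999, Ch. I §9] -/
theorem exists_inertia_nine_eq_four_of_not_hasGoodReductionAt
    (W : WeierstrassCurve ℚ) [W.IsElliptic] [W.IsGloballyMinimal]
    (hO6 : ClassO6 W 3) (hev : Even (padicValInt 3 W.minimalDiscriminantInt))
    (hsq : W.minimalDiscriminantInt / 3 ^ padicValInt 3 W.minimalDiscriminantInt % 3 = 1)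
    (ℓ : ℕ) [Fact ℓ.Prime] (hℓ : ℓ ≠ 3)
    {L : Type} [Field L] [NumberField L] (F : IntermediateField ℚ L) {ζ : F} (hζ : IsPrimitiveRoot ζ 3)
    {w : HeightOneSpectrum (𝓞 F)} (hw3 : ((3 : ℕ) : 𝓞 F) ∈ w.asIdeal)
    (hbad : ¬ (W.baseChange F).HasGoodReductionAt w) :
    ∃ (v : HeightOneSpectrum (𝓞 ℚ)) (𝔓 : Ideal (absIntegers (𝓞 ℚ) ℚ)), 𝔓 ∈ v.primesAbove ∧
      (3 : 𝓞 ℚ) ∈ v.asIdeal ∧ ∃ i ∈ 𝔓.inertia (absoluteGaloisGroup ℚ),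
        (modNCyclotomicCharacter ℚ 9 i : ZMod 9) = 4 ∧ W.rationalGaloisRepTate ℓ i ≠ 1 := by
  classical
  haveI : NeZero ((9 : ℕ) : ℚ) := ⟨by norm_num⟩
  haveI : (W.baseChange F).IsElliptic := by rw [WeierstrassCurve.baseChange]; infer_instance
  -- `ℓ ∉ w` (as `3 ∈ w` and `ℓ ≠ 3`)
  have hℓw : ((ℓ : ℕ) : 𝓞 F) ∉ w.asIdeal := by
    intro hmem
    have hcop : Nat.Coprime ℓ 3 := (Nat.coprime_primes Fact.out Nat.prime_three).mpr hℓ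
    obtain ⟨a, b, hab⟩ := Nat.Coprime.isCoprime hcop
    apply w.isPrime.ne_top
    rw [Ideal.eq_top_iff_one]
    have h1 : (a : 𝓞 F) * ((ℓ : ℕ) : 𝓞 F) + (b : 𝓞 F) * ((3 : ℕ) : 𝓞 F) ∈ w.asIdeal :=
      w.asIdeal.add_mem (w.asIdeal.mul_mem_left _ hmem) (w.asIdeal.mul_mem_left _ hw3)
    have h2 : (a : 𝓞 F) * ((ℓ : ℕ) : 𝓞 F) + (b : 𝓞 F) * ((3 : ℕ) : 𝓞 F) = 1 := by
      have h := congrArg (Int.cast : ℤ → 𝓞 F) hab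
      push_cast at h ⊢
      exact h
    rwa [h2] at h1
  -- Néron–Ogg–Shafarevich: an inertia element `τ ∈ I_𝔔 ≤ Γ_F`, `𝔔 ∣ w`, moving `T_ℓ(W ×_ℚ F)`
  have hNOS := WeierstrassCurve.neronOggShafarevich_holds (W.baseChange F)
  obtain ⟨𝔔, h𝔔, τ, hτ, hρτ⟩ : ∃ 𝔔 ∈ w.primesAbove, ∃ τ ∈ 𝔔.inertia (absoluteGaloisGroup F),
      (W.baseChange F).galoisRepTate ℓ τ ≠ 1 := by
    by_contra h
    push Not at h
    exact hbad (hNOS w ℓ hℓw h)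
  obtain ⟨b, hb⟩ := exists_smul_ne_of_galoisRepTate_ne_one (W.baseChange F) ℓ hρτ
  -- its restriction `i ∈ Γ_ℚ` moves `T_ℓ(W)`, hence acts non-trivially on `V_ℓ(W)`
  set i : absoluteGaloisGroup ℚ := absGaloisRestrict ℚ F τ with hi_def
  have ha : i • (tateModuleEquiv W F ℓ).symm b ≠ (tateModuleEquiv W F ℓ).symm b := by
    rw [hi_def, ← tateModuleEquiv_symm_smul W F ℓ τ b]
    exact fun h => hb ((tateModuleEquiv W F ℓ).symm.injective h)
  have hρi : W.rationalGaloisRepTate ℓ i ≠ 1 := rationalGaloisRepTate_ne_one_of_smul_ne W ℓ ha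
  -- `i` lies in the inertia group of `𝔓 = 𝔔 ∩ ℤ̄`, a prime above the place `v ∋ 3` of `ℚ` under `w`
  set 𝔓 : Ideal (absIntegers (𝓞 ℚ) ℚ) := 𝔔.comap (absIntegersMap ℚ F) with h𝔓_def
  have hi𝔓 : i ∈ 𝔓.inertia (absoluteGaloisGroup ℚ) := absGaloisRestrict_mem_inertia_comap ℚ F hτ
  haveI : w.asIdeal.IsPrime := w.isPrime
  have hv3' : ((3 : ℕ) : 𝓞 ℚ) ∈ w.asIdeal.under (𝓞 ℚ) := by
    rw [Ideal.under_def, Ideal.mem_comap, map_natCast]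
    exact hw3
  have hne : w.asIdeal.under (𝓞 ℚ) ≠ ⊥ := by
    intro h0
    rw [h0, Ideal.mem_bot, Nat.cast_eq_zero] at hv3'
    exact absurd hv3' (by norm_num)
  let v : HeightOneSpectrum (𝓞 ℚ) := ⟨w.asIdeal.under (𝓞 ℚ), inferInstance, hne⟩
  have hv3 : (3 : 𝓞 ℚ) ∈ v.asIdeal := by
    have h := hv3'
    rw [Nat.cast_ofNat] at h
    exact h
  have h𝔓 : 𝔓 ∈ v.primesAbove := comap_absIntegersMap_mem_primesAbove (v := v) rfl h𝔔
  -- `i` fixes the primitive cube root of unity `e(ζ) ∈ ℚ̄`, so `χ₉(i) ∈ {1, 4, 7}`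
  have hω : IsPrimitiveRoot (absEmbedding ℚ F ζ) 3 := hζ.map_of_injective (absEmbedding ℚ F).injective
  have hfix : i • absEmbedding ℚ F ζ = absEmbedding ℚ F ζ := by
    rw [hi_def]; exact absGaloisRestrict_smul_absEmbedding ℚ F τ ζ
  have h147 := modNCyclotomicCharacter_nine_of_smul_eq_of_isPrimitiveRoot_three hω hfix
  -- the tree theorem: `χ₉(j) = 1`, `j ∈ I_𝔓` ⟹ `ρ(j) = 1` on `V₂(W)` (good reduction over `ℚ(ζ₉)`)
  have htriv : ∀ {j : absoluteGaloisGroup ℚ}, j ∈ 𝔓.inertia (absoluteGaloisGroup ℚ) →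
      (modNCyclotomicCharacter ℚ 9 j : ZMod 9) = 1 → W.rationalGaloisRepTate ℓ j = 1 := by
    intro j hj hχj
    have hχj' : modNCyclotomicCharacter ℚ 9 j = 1 := Units.val_eq_one.mp hχj
    exact LinearMap.ext fun x =>
      rationalGaloisRepTate_apply_eq_self_of_mem_inertia_of_modNCyclotomicCharacter_eq_one W hO6 hev hsq ℓ
        hℓ hv3 h𝔓 hj hχj' x
  rcases h147 with h1 | h4 | h7
  · -- `χ₉(i) = 1`: impossible, `i` acts non-trivially
    exact absurd (htriv hi𝔓 h1) hρi
  · -- `χ₉(i) = 4`: done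
    exact ⟨v, 𝔓, h𝔓, hv3, i, hi𝔓, h4, hρi⟩
  · -- `χ₉(i) = 7`: take `i²`
    refine ⟨v, 𝔓, h𝔓, hv3, i ^ 2, Subgroup.pow_mem _ hi𝔓 2, ?_, ?_⟩
    · rw [map_pow, Units.val_pow_eq_pow_val, h7]; decide
    · intro h2
      have h3 : (modNCyclotomicCharacter ℚ 9 (i ^ 3) : ZMod 9) = 1 := by
        rw [map_pow, Units.val_pow_eq_pow_val, h7]; decide
      have hρ3 : W.rationalGaloisRepTate ℓ (i ^ 3) = 1 := htriv (Subgroup.pow_mem _ hi𝔓 3) h3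
      apply hρi
      rw [map_pow, pow_succ, ← map_pow, h2, one_mul] at hρ3
      exact hρ3

/-! ### §4 The principal-series rows: every `ℓ ≠ 3`, and the registered stub (`ℓ = 2`) -/

/-- **Wild `ℓ`-adic inertia at `3` on the principal-series rows, unconditionally** (every prime `ℓ ≠ 3`): for a
globally minimal `W/ℚ` with `ClassO6 W 3`, `v₃(Δ_min)` even and unit part `≡ 1 (mod 3)`, some `i` in an inertia group
`I_𝔓 ≤ Γ_ℚ` above `3` has `χ₉(i) = 4` and `ρ_{W,ℓ}(i) ≠ 1` on `V_ℓ(W)`. `ClassO6 W 3 ⟹ ¬ TypeG W 3` (tree), so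
`W ×_ℚ K` has bad reduction above `3` over the top intermediate field `K ≅ ℚ(ζ₃)` of the third cyclotomic field; then
`exists_inertia_nine_eq_four_of_not_hasGoodReductionAt`. [cite: SilvermanAEC2009, Thm. VII.7.1]
[cite: SerreTate1968, §1–§2] [cite: Delbourgo1998, §1.5 (G)] -/
theorem exists_inertia_nine_eq_four_rationalGaloisRepTate_ne_one
    (W : WeierstrassCurve ℚ) [W.IsElliptic] [W.IsGloballyMinimal]
    (hO6 : ClassO6 W 3) (hev : Even (padicValInt 3 W.minimalDiscriminantInt))
    (hsq : W.minimalDiscriminantInt / 3 ^ padicValInt 3 W.minimalDiscriminantInt % 3 = 1)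
    (ℓ : ℕ) [Fact ℓ.Prime] (hℓ : ℓ ≠ 3) :
    ∃ (v : HeightOneSpectrum (𝓞 ℚ)) (𝔓 : Ideal (absIntegers (𝓞 ℚ) ℚ)), 𝔓 ∈ v.primesAbove ∧
      (3 : 𝓞 ℚ) ∈ v.asIdeal ∧ ∃ i ∈ 𝔓.inertia (absoluteGaloisGroup ℚ),
        (modNCyclotomicCharacter ℚ 9 i : ZMod 9) = 4 ∧ W.rationalGaloisRepTate ℓ i ≠ 1 := by
  classical
  -- the third cyclotomic field (canonical `ℚ`-algebra structure) and its top intermediate field `K ≅ ℚ(ζ₃)`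
  haveI : NeZero ((3 : ℕ) : ℚ) := ⟨by norm_num⟩
  haveI hcyc : IsCyclotomicExtension {3} ℚ (CyclotomicField 3 ℚ) := by
    have h : (CyclotomicField.algebra 3 ℚ : Algebra ℚ (CyclotomicField 3 ℚ)) =
        DivisionRing.toRatAlgebra :=
      Subsingleton.elim _ _
    exact h ▸ CyclotomicField.isCyclotomicExtension 3 ℚ
  haveI hL : NumberField (CyclotomicField 3 ℚ) := IsCyclotomicExtension.numberField {3} ℚ _
  -- `W` is wild at `3`, hence NOT of Delbourgo type (G): no good reduction above `3` over `K`
  have hG : ¬ TypeG W 3 := (ClassO6.not_typeG_three (W := W) hO6).1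
  obtain ⟨w, hw3, hbad⟩ : ∃ w : HeightOneSpectrum (𝓞 (⊤ : IntermediateField ℚ (CyclotomicField 3 ℚ))),
      ((3 : ℕ) : 𝓞 (⊤ : IntermediateField ℚ (CyclotomicField 3 ℚ))) ∈ w.asIdeal ∧
        ¬ (W.baseChange (⊤ : IntermediateField ℚ (CyclotomicField 3 ℚ))).HasGoodReductionAt w := by
    by_contra h
    push Not at h
    exact hG ⟨CyclotomicField 3 ℚ, inferInstance, inferInstance, hcyc, ⊤, h⟩
  -- a primitive cube root of unity in `K`
  have hζ : IsPrimitiveRoot (⟨zeta 3 ℚ (CyclotomicField 3 ℚ), IntermediateField.mem_top⟩ :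
      (⊤ : IntermediateField ℚ (CyclotomicField 3 ℚ))) 3 :=
    IsPrimitiveRoot.of_map_of_injective (f := (⊤ : IntermediateField ℚ (CyclotomicField 3 ℚ)).val)
      (by exact IsCyclotomicExtension.zeta_spec 3 ℚ (CyclotomicField 3 ℚ)) (RingHom.injective _)
  exact exists_inertia_nine_eq_four_of_not_hasGoodReductionAt W hO6 hev hsq ℓ hℓ ⊤ hζ hw3 hbad


/-- **stub_WILD of line `dfrob_wan` (K1 = stmt-BirchSwinnertonDyer-21580, skeleton v7), VERBATIM and UNCONDITIONALLY.**
For every globally minimal `W/ℚ` on a principal-series row at `3` (`ClassO6 W 3`, `v₃(Δ_min)` even, unit part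
`≡ 1 (mod 3)`): there are a place `v ∋ 3` of `ℚ`, a prime `𝔓 ∣ v` of `ℤ̄` and `i ∈ I_𝔓 ≤ Γ_ℚ` with mod-`9` cyclotomic
character `χ₉(i) = 4` acting NON-trivially on `V₂(W)` — the `2`-adic inertia at `3` is WILD. No modularity, no
Carayol, no newform: `ClassO6 W 3 ⟹ ¬ TypeG W 3` (tree: a type-(G) additive pair at `3` is tame, `f₃ = 2`), so
`W ×_ℚ K` has bad reduction above `3` for `K = ℚ(ζ₃)` (the top intermediate field of the third cyclotomic field);
then `exists_inertia_nine_eq_four_of_not_hasGoodReductionAt` (Néron–Ogg–Shafarevich + restriction `Γ_K → Γ_ℚ` +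
the `ℚ(ζ₉)`-good-reduction factorisation of the inertia action). [cite: SilvermanAEC2009, Thm. VII.7.1]
[cite: SerreTate1968, §1–§2] [cite: Delbourgo1998, §1.5 (G)] -/
theorem stub_WILD_unconditional :
    ∀ (W : WeierstrassCurve ℚ) [W.IsElliptic] [W.IsGloballyMinimal],
      Summit.BirchSwinnertonDyer.Rank1Residual.Additive.ClassO6 W 3 →
      Even (padicValInt 3 W.minimalDiscriminantInt) →
      W.minimalDiscriminantInt / 3 ^ padicValInt 3 W.minimalDiscriminantInt % 3 = 1 →
      ∃ (v : IsDedekindDomain.HeightOneSpectrum (NumberField.RingOfIntegers ℚ))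
        (𝔓 : Ideal (Literature.NumberTheory.GaloisRepresentations.absIntegers (NumberField.RingOfIntegers ℚ) ℚ)),
        𝔓 ∈ v.primesAbove ∧
        (3 : NumberField.RingOfIntegers ℚ) ∈ v.asIdeal ∧ ∃ i ∈ 𝔓.inertia (Field.absoluteGaloisGroup ℚ),
          (Literature.NumberTheory.GaloisRepresentations.modNCyclotomicCharacter ℚ 9 i : ZMod 9) = 4 ∧
            W.rationalGaloisRepTate 2 i ≠ 1 := by
  intro W _ _ hO6 hev hsq
  exact exists_inertia_nine_eq_four_rationalGaloisRepTate_ne_one W hO6 hev hsq 2 (by norm_num)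

end Summit.BirchSwinnertonDyer.BirchSwinnertonDyer.Theorems.InertiaWildAtThreeUnconditional

end
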